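import Summits.ABC.IUTFork.LDHGenuineHullRegimeContentFree
import Summits.ABC.IUTFork.LDHGenuineHullRegimeSzpiroSlack
import HarnessLib

/-!
# The fork at [IUTchIII] Corollary 3.12, L-DH level, READING (U) — HONEST-SCOPE CERTIFICATE for the FULL slack of `B_III`:
# the Szpiro-slack hull estimates of abc-iut-s2-p1 (`LDHGenuineHullRegimeSzpiroSlack`) also live in the content-free range of
# [IUTchIV] Thm. 1.10's display (abc-iut cell, crux ThetaPartII = stmt-ABC-19678, stub `stub_hullRegime` / VERDICT RISK ¶7)

Record-only file (D-0012) of the abc-iut cell (WAVE-3 discharge seat abc-iut-c312-d1, gen 6); TAKES NO SIDE on [IUTchIII]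
Cor. 3.12 or on the (U)/(P) readings. Sequel to this seat's `LDHGenuineHullRegimeContentFree` (the π-form prime-counting slack is
content-free: `40·log x·π(x) ≤ 115·x`). abc-iut-s2-p1 kept, in addition, the Step (iii) conductor share
`((l+1)/4)·(4(d_mod−1)/l)·(log-diff + log-cond)` of print's `B_III(P,l)` and proved the (U)-volume body at every datum under the
SZPIRO-TYPE sufficient conditions
`log(q^{∤{2,l}}(λ)) ≤ (24(d_mod−1)/l)·(log-diff + log-cond) + 40·log(d*·l)·(π(d*·l) − C(P,l)/log 2)`
(`PointDict.hullVolumeAtDatum_BIII_of_logQAvoid_le_szpiro`) and `log(q^{∤{2,l}}(λ)) ≤ (24(d_mod−1)/l)·(log-diff + log-cond)`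
(`…_szpiro'`). THIS FILE records that BOTH sufficient regions are again regions where the display
`(1/6)·log q ≤ (1 + 20·d_mod/l)·(log-diff + log 𝔣) + 20·(d*·l + η)` holds OUTRIGHT — because
`(1/6)·(24(d_mod−1)/l) = 4(d_mod−1)/l ≤ 1 + 20·d_mod/l` and `(1/6)·115 < 20`:

* `Cor22.display_of_logQAvoid_le_szpiroSlackThreshold` — the hypothesis of `…_of_logQAvoid_le_szpiro` gives `Cor22.Display P l η`;
* `Cor22.display_of_logQAvoid_le_szpiroPure` — the hypothesis of `…_of_logQAvoid_le_szpiro'` gives `Cor22.Display P l η`;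
* `PointDict.display_and_hullVolumeAtDatum_of_logQAvoid_le_szpiro` / `…_szpiro'` — the conjunctions at admissible `P`, `l ≥ 7`.

Reading for VERDICT RISK ¶7 (kernel): the WHOLE slack of print's constant `B_III` — prime-count part and conductor share — buys
the (U)-hull estimate only where [IUTchIV] Thm. 1.10's display is content-free; a contentful instance of the display via the (U)
line needs `slotResidue ≤ B_III − δ_explicit` beyond the slack (abc-iut-S8: forced; abc-iut-s2-p1/S7: Szpiro type in both
directions). Reading (P) is unaffected. [cite: Mochizuki2012, IUTchIV Thm. 1.10 p. 22–23, proof Steps (ii)–(viii) p. 24–30]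
[claim: Mochizuki2012, status: disputed] for the IUT quotations; the content of this file is elementary real arithmetic.
-/

noncomputable section

namespace Literature.IUT.LogVolume

namespace Cor22

open Literature.NumberTheory.DiophantineGeometry.GenEll

variable {P : NFPoint} {l : ℕ}

/-- **The Szpiro-slack region is content-free**: for `l ≥ 5`, `η ≥ 0`, if
`log(q^{∤{2,l}}(λ)) ≤ (24(d_mod−1)/l)·(log-diff + log-cond) + 40·log(d*·l)·(π(d*·l) − C(P,l)/log 2)` (the hypothesis of
abc-iut-s2-p1's `PointDict.hullVolumeAtDatum_BIII_of_logQAvoid_le_szpiro`), then `Cor22.Display P l η`.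
[cite: Mochizuki2012, IUTchIV Thm. 1.10 p. 22–23] [claim: Mochizuki2012, status: disputed] -/
theorem display_of_logQAvoid_le_szpiroSlackThreshold (hl : 5 ≤ l)
    (h : Cor22.logQAvoid P {2, l} ≤
      24 * ((Cor22.dmod P : ℝ) - 1) / l * (P.logDiff + Cor22.logCondAvoid P {2, l})
      + 40 * Real.log (((2 ^ 12 * 3 ^ 3 * 5 * Cor22.dmod P : ℕ) : ℝ) * l)
        * ((Nat.primeCounting (2 ^ 12 * 3 ^ 3 * 5 * Cor22.dmod P * l) : ℝ)
          - (2 * (Cor22.dmod P : ℝ) * (P.logDiff + Cor22.logCondAvoid P {2, l}) + Real.log (2 * 3 * 5 * (l : ℝ)))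
            / Real.log 2))
    {η : ℝ} (hη : 0 ≤ η) : Cor22.Display P l η := by
  have hπ := slackThreshold_le (P := P) hl
  have hcast : (((2 ^ 12 * 3 ^ 3 * 5 * Cor22.dmod P * l : ℕ) : ℝ)) = 2 ^ 12 * 3 ^ 3 * 5 * (Cor22.dmod P : ℝ) * l := by
    push_cast; ring
  rw [hcast] at hπ
  unfold Cor22.Display
  have hLD : 0 ≤ P.logDiff + Cor22.logCondAvoid P {2, l} := add_nonneg P.logDiff_nonneg (Cor22.logCondAvoid_nonneg P _)
  have hl' : (5 : ℝ) ≤ l := by exact_mod_cast hl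
  have hl0 : (0 : ℝ) < l := by linarith
  have hd : (1 : ℝ) ≤ Cor22.dmod P := by exact_mod_cast Cor22.dmod_pos P
  have hN0 : 0 ≤ (2 : ℝ) ^ 12 * 3 ^ 3 * 5 * (Cor22.dmod P : ℝ) * l := by positivity
  -- the conductor share: `(1/6)·24(d−1)/l = 4(d−1)/l ≤ 1 + 20·d/l`
  have hshare : 1 / 6 * (24 * ((Cor22.dmod P : ℝ) - 1) / l * (P.logDiff + Cor22.logCondAvoid P {2, l})) ≤
      (1 + 20 * (Cor22.dmod P : ℝ) / l) * (P.logDiff + Cor22.logCondAvoid P {2, l}) := by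
    have hc : 1 / 6 * (24 * ((Cor22.dmod P : ℝ) - 1) / l) ≤ 1 + 20 * (Cor22.dmod P : ℝ) / l := by
      rw [show 1 / 6 * (24 * ((Cor22.dmod P : ℝ) - 1) / l) = 4 * ((Cor22.dmod P : ℝ) - 1) / l by ring]
      rw [div_le_iff₀ hl0, add_mul, div_mul_cancel₀ _ hl0.ne']
      nlinarith
    calc 1 / 6 * (24 * ((Cor22.dmod P : ℝ) - 1) / l * (P.logDiff + Cor22.logCondAvoid P {2, l}))
        = (1 / 6 * (24 * ((Cor22.dmod P : ℝ) - 1) / l)) * (P.logDiff + Cor22.logCondAvoid P {2, l}) := by ring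
      _ ≤ (1 + 20 * (Cor22.dmod P : ℝ) / l) * (P.logDiff + Cor22.logCondAvoid P {2, l}) :=
          mul_le_mul_of_nonneg_right hc hLD
  nlinarith [hshare, hπ, hN0, hη, h]

/-- **The pure Szpiro region is content-free**: for `l ≥ 1`, `η ≥ 0`, if `log(q^{∤{2,l}}(λ)) ≤ (24(d_mod−1)/l)·(log-diff + log-cond)`
(the hypothesis of abc-iut-s2-p1's `PointDict.hullVolumeAtDatum_BIII_of_logQAvoid_le_szpiro'`), then `Cor22.Display P l η`.
[cite: Mochizuki2012, IUTchIV Thm. 1.10 p. 22–23] [claim: Mochizuki2012, status: disputed] -/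
theorem display_of_logQAvoid_le_szpiroPure (hl : 1 ≤ l)
    (h : Cor22.logQAvoid P {2, l} ≤ 24 * ((Cor22.dmod P : ℝ) - 1) / l * (P.logDiff + Cor22.logCondAvoid P {2, l}))
    {η : ℝ} (hη : 0 ≤ η) : Cor22.Display P l η := by
  unfold Cor22.Display
  have hLD : 0 ≤ P.logDiff + Cor22.logCondAvoid P {2, l} := add_nonneg P.logDiff_nonneg (Cor22.logCondAvoid_nonneg P _)
  have hl' : (1 : ℝ) ≤ l := by exact_mod_cast hl
  have hl0 : (0 : ℝ) < l := by linarith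
  have hd : (1 : ℝ) ≤ Cor22.dmod P := by exact_mod_cast Cor22.dmod_pos P
  have hN0 : 0 ≤ (2 : ℝ) ^ 12 * 3 ^ 3 * 5 * (Cor22.dmod P : ℝ) * l := by positivity
  have hshare : 1 / 6 * (24 * ((Cor22.dmod P : ℝ) - 1) / l * (P.logDiff + Cor22.logCondAvoid P {2, l})) ≤
      (1 + 20 * (Cor22.dmod P : ℝ) / l) * (P.logDiff + Cor22.logCondAvoid P {2, l}) := by
    have hc : 1 / 6 * (24 * ((Cor22.dmod P : ℝ) - 1) / l) ≤ 1 + 20 * (Cor22.dmod P : ℝ) / l := by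
      rw [show 1 / 6 * (24 * ((Cor22.dmod P : ℝ) - 1) / l) = 4 * ((Cor22.dmod P : ℝ) - 1) / l by ring]
      rw [div_le_iff₀ hl0, add_mul, div_mul_cancel₀ _ hl0.ne']
      nlinarith
    calc 1 / 6 * (24 * ((Cor22.dmod P : ℝ) - 1) / l * (P.logDiff + Cor22.logCondAvoid P {2, l}))
        = (1 / 6 * (24 * ((Cor22.dmod P : ℝ) - 1) / l)) * (P.logDiff + Cor22.logCondAvoid P {2, l}) := by ring
      _ ≤ (1 + 20 * (Cor22.dmod P : ℝ) / l) * (P.logDiff + Cor22.logCondAvoid P {2, l}) :=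
          mul_le_mul_of_nonneg_right hc hLD
  nlinarith [hshare, hN0, hη, h]

end Cor22

end Literature.IUT.LogVolume

namespace Summit.ABC.IUTFork

namespace PointDict

open Literature.IUT.LogVolume Literature.NumberTheory.DiophantineGeometry.GenEll

variable {P : NFPoint} {l : ℕ}

/-- **Szpiro-slack form: BOTH the (U)-volume edge (abc-iut-s2-p1) and the display are theorems under the one hypothesis**
(admissible `P`, `l ≥ 7`, `η ≥ 0`). [cite: Mochizuki2012, IUTchIV Thm. 1.10 p. 22–23] [claim: Mochizuki2012, status: disputed] -/
theorem display_and_hullVolumeAtDatum_of_logQAvoid_le_szpiro (hP : P ∈ UP) (h7 : 7 ≤ l)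
    (h : Cor22.logQAvoid P {2, l} ≤
      24 * ((Cor22.dmod P : ℝ) - 1) / l * (P.logDiff + Cor22.logCondAvoid P {2, l})
      + 40 * Real.log (((2 ^ 12 * 3 ^ 3 * 5 * Cor22.dmod P : ℕ) : ℝ) * l)
        * ((Nat.primeCounting (2 ^ 12 * 3 ^ 3 * 5 * Cor22.dmod P * l) : ℝ)
          - (2 * (Cor22.dmod P : ℝ) * (P.logDiff + Cor22.logCondAvoid P {2, l}) + Real.log (2 * 3 * 5 * (l : ℝ)))
            / Real.log 2))
    {η : ℝ} (hη : 0 ≤ η) :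
    Cor22.Display P l η ∧
      Cor22.HullVolumeAtDatum P l (((l : ℝ) + 1) / 4 * ((1 + 12 * (Cor22.dmod P : ℝ) / l)
        * (P.logDiff + Cor22.logCondAvoid P {2, l}) + 2 * Real.log l + 52
          + 20 / 3 * Real.log (((2 ^ 12 * 3 ^ 3 * 5 * Cor22.dmod P : ℕ) : ℝ) * (l : ℝ))
            * (Nat.primeCounting (2 ^ 12 * 3 ^ 3 * 5 * Cor22.dmod P * l) : ℝ))) :=
  ⟨Cor22.display_of_logQAvoid_le_szpiroSlackThreshold (le_trans (by norm_num) h7) h hη,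
    hullVolumeAtDatum_BIII_of_logQAvoid_le_szpiro hP h7 h⟩

/-- **Pure Szpiro form: BOTH the (U)-volume edge (abc-iut-s2-p1 `…_szpiro'`) and the display are theorems under the one
hypothesis** (admissible `P`, `l ≥ 7`, `η ≥ 0`). [cite: Mochizuki2012, IUTchIV Thm. 1.10 p. 22–23] [claim: Mochizuki2012, status: disputed] -/
theorem display_and_hullVolumeAtDatum_of_logQAvoid_le_szpiro' (hP : P ∈ UP) (h7 : 7 ≤ l)
    (h : Cor22.logQAvoid P {2, l} ≤ 24 * ((Cor22.dmod P : ℝ) - 1) / l * (P.logDiff + Cor22.logCondAvoid P {2, l}))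
    {η : ℝ} (hη : 0 ≤ η) :
    Cor22.Display P l η ∧
      Cor22.HullVolumeAtDatum P l (((l : ℝ) + 1) / 4 * ((1 + 12 * (Cor22.dmod P : ℝ) / l)
        * (P.logDiff + Cor22.logCondAvoid P {2, l}) + 2 * Real.log l + 52
          + 20 / 3 * Real.log (((2 ^ 12 * 3 ^ 3 * 5 * Cor22.dmod P : ℕ) : ℝ) * (l : ℝ))
            * (Nat.primeCounting (2 ^ 12 * 3 ^ 3 * 5 * Cor22.dmod P * l) : ℝ))) :=
  ⟨Cor22.display_of_logQAvoid_le_szpiroPure (le_trans (by norm_num) h7) h hη,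
    hullVolumeAtDatum_BIII_of_logQAvoid_le_szpiro' hP h7 h⟩

end PointDict

end Summit.ABC.IUTFork

end
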